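import Mathlib.MeasureTheory.Group.Measure
import Mathlib.MeasureTheory.Measure.Prod
import Mathlib.MeasureTheory.Measure.WithDensity
import Mathlib.Analysis.Normed.Group.Basic
import HarnessLib

/-!
# The SKEW-PRODUCT CHART IDENTITY: a product measure `ν ⊗ κ` with `κ` LEFT-INVARIANT on a group, re-parametrised fibrewise by
# `(p, y) ↦ (p, s(p)·E(y))` through a one-fibre chart `E` and a measurable section `s` — the `hchart` hypothesis of the fibred Laplace
# method for «base = near-flat leaders, fibre = followers at the implicit minimiser»
# (free-hands support of ⟨stmt-QuantumFields-24197⟩ `SwapVirialDeficit.SwapGluedStiffness`; generic measure theory, companion of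
# ✓`SwapVirialDeficitQuantitativeLaplaceFibredChart` ∕ ✓`…FibreMinimiser`)

Setting.  `(M, ν)` an s-finite measure space (the base), `Y` a measurable group with an s-finite LEFT-INVARIANT measure `κ` (the fibre: e.g.
`SU(2)^{Fol}` with its Haar measure), `V` a real normed space (the chart domain) with a measure `vol`, `E : V → Y` a measurable one-fibre chart on the
closed ball `B = B̄(0,R)` with the chart identity `κ|_{E(B)} = E_*((j·vol)|_B)` (`j ≥ 0` on `B`, measurable; `E(B)` measurable), and `s : M → Y` a
MEASURABLE SECTION (the fibre minimiser `y*(p)`).  The skew-product chart is `Ψ(p, y) = (p, s(p)·E(y))` and the tube `T = M × B`.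
* ★ `measurableSet_image_skewChart` — `Ψ(T) = {(p, z) : s(p)⁻¹·z ∈ E(B)}` is measurable;
* ★★★ `skewChart_restrict_image_eq_map` — THE CHART IDENTITY
  `(ν ⊗ κ)|_{Ψ(T)} = Ψ_*((J · ν ⊗ vol)|_T)` with the `p`-INDEPENDENT Jacobian `J(p, y) = j(y)`
  (left-invariance of `κ` absorbs the translation by `s(p)`; Tonelli on both sides).
So the tubular-coordinate hypothesis `hchart` of ✓`laplaceMethod_quantitative_fibred_chart[_of_taylor]` holds for `X = M × Y`, `μ = ν ⊗ κ`, with NO geometry of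
the (singular) critical set: only a measurable section and the one-fibre chart are needed.

HONEST FRAMING: measure theory; width 0 by itself toward any lattice statement; ⟨24197⟩, ⟨24196⟩, ⟨24194⟩, ⟨24497⟩ and every rung ∕ summit statement stay OPEN;
own crux ⟨22884⟩ OPEN (blocked-on ⟨19935⟩); the Yang–Mills mass gap is NOT proved; no summit is proved by a line.  Width seat ym-line-sfw-p2-w2 g58 (cell
ym-idea-1, free hands), `--supports stmt-QuantumFields-24197`.  THEOREMS ONLY (0 `def`, 0 `sorry`), standard axioms.

## References
* M. Hasenpflug, D. Rudolf, B. Sprungk, *Wasserstein convergence rates of increasingly concentrating probability measures*, Ann. Appl. Probab. 34 (2024),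
  §3.1 Assumption 3 (T) (tubular coordinates and the reference measure in them). [HasenpflugRudolfSprungk2024]
* S. Helgason, *Groups and Geometric Analysis*, AMS (2000), Ch. I §1 Thm 1.14 (Haar measure in exponential coordinates — the model one-fibre chart). [folklore]
-/

set_option autoImplicit false

noncomputable section

open _root_.MeasureTheory _root_.Set _root_.Metric
open scoped _root_.ENNReal

namespace Summit.QuantumFields.YangMills.Theorems.QuantitativeLaplace

variable {M : Type*} [MeasurableSpace M] {ν : Measure M} [SFinite ν]
variable {Y : Type*} [Group Y] [MeasurableSpace Y] [MeasurableMul₂ Y] [MeasurableInv Y] {κ : Measure Y} [SFinite κ]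
  [κ.IsMulLeftInvariant]
variable {V : Type*} [NormedAddCommGroup V] [MeasurableSpace V] [BorelSpace V] {vol : Measure V} [SFinite vol]

omit [SFinite ν] [SFinite κ] [κ.IsMulLeftInvariant] [NormedAddCommGroup V] [MeasurableSpace V] [BorelSpace V] [SFinite vol] in
/-- ★ **The image of the tube under the skew-product chart is measurable**: `Ψ(M × B) = {(p,z) : s(p)⁻¹·z ∈ E(B)}`. [folklore] -/
theorem measurableSet_image_skewChart {E : V → Y} {s : M → Y} (hs : Measurable s) {B : Set V} (hEB : MeasurableSet (E '' B)) :
    (fun z : M × V => ((z.1, s z.1 * E z.2) : M × Y)) '' (univ ×ˢ B) =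
      (fun q : M × Y => (s q.1)⁻¹ * q.2) ⁻¹' (E '' B) ∧
    MeasurableSet ((fun z : M × V => ((z.1, s z.1 * E z.2) : M × Y)) '' (univ ×ˢ B)) := by
  have heq : (fun z : M × V => ((z.1, s z.1 * E z.2) : M × Y)) '' (univ ×ˢ B) =
      (fun q : M × Y => (s q.1)⁻¹ * q.2) ⁻¹' (E '' B) := by
    ext ⟨p, z⟩
    simp only [mem_image, mem_prod, mem_univ, true_and, Prod.mk.injEq, mem_preimage, Prod.exists]
    constructor
    · rintro ⟨p', y, hy, rfl, rfl⟩
      exact ⟨y, hy, by rw [inv_mul_cancel_left]⟩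
    · rintro ⟨y, hy, hyz⟩
      exact ⟨p, y, hy, rfl, by rw [hyz, mul_inv_cancel_left]⟩
  refine ⟨heq, ?_⟩
  rw [heq]
  exact ((hs.comp measurable_fst).inv.mul measurable_snd) hEB

/-- ★★★ **THE SKEW-PRODUCT CHART IDENTITY.**  With `Ψ(p,y) = (p, s(p)·E(y))`, `T = M × B̄(0,R)`, a LEFT-INVARIANT s-finite `κ` on the group `Y`, the one-fibre
chart identity `κ|_{E(B)} = E_*((j·vol)|_B)` (`j ≥ 0` measurable, `E(B)` measurable, `E` measurable) and a measurable section `s`: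
`(ν ⊗ κ)|_{Ψ(T)} = Ψ_*(((ν ⊗ vol)|_T)·(j ∘ snd))` — the Jacobian does not depend on the base point. [cite: HasenpflugRudolfSprungk2024, §3.1 Assumption 3 (T)] -/
theorem skewChart_restrict_image_eq_map {E : V → Y} (hE : Measurable E) {s : M → Y} (hs : Measurable s) {R : ℝ}
    {j : V → ℝ} (hjm : Measurable j) (hEB : MeasurableSet (E '' closedBall (0 : V) R))
    (hchart1 : κ.restrict (E '' closedBall (0 : V) R) =
      ((vol.restrict (closedBall (0 : V) R)).withDensity fun y => ENNReal.ofReal (j y)).map E) :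
    (ν.prod κ).restrict ((fun z : M × V => ((z.1, s z.1 * E z.2) : M × Y)) '' (univ ×ˢ closedBall (0 : V) R)) =
      (((ν.prod vol).restrict (univ ×ˢ closedBall (0 : V) R)).withDensity fun z => ENNReal.ofReal (j z.2)).map
        (fun z : M × V => ((z.1, s z.1 * E z.2) : M × Y)) := by
  set B : Set V := closedBall (0 : V) R with hBdef
  have hBm : MeasurableSet B := measurableSet_closedBall
  set Ψ : M × V → M × Y := fun z => (z.1, s z.1 * E z.2) with hΨdef
  have hΨm : Measurable Ψ := measurable_fst.prodMk ((hs.comp measurable_fst).mul (hE.comp measurable_snd))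
  obtain ⟨himg, hTm⟩ := measurableSet_image_skewChart (E := E) hs (B := B) hEB
  have hTm' : MeasurableSet (Ψ '' (univ ×ˢ B)) := hTm
  set g : M × V → ℝ≥0∞ := fun z => ENNReal.ofReal (j z.2) with hgdef
  have hgm : Measurable g := ENNReal.measurable_ofReal.comp (hjm.comp measurable_snd)
  ext S hS
  -- RIGHT: the pushed-forward weighted product measure, by Tonelli
  have hR : ((((ν.prod vol).restrict (univ ×ˢ B)).withDensity g).map Ψ) S =
      ∫⁻ p, ∫⁻ y in B, (Ψ ⁻¹' S).indicator g (p, y) ∂vol ∂ν := by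
    rw [Measure.map_apply hΨm hS, withDensity_apply _ (hΨm hS), ← Measure.prod_restrict, Measure.restrict_univ,
      ← lintegral_indicator (hΨm hS), lintegral_prod _ ((hgm.indicator (hΨm hS)).aemeasurable)]
  -- LEFT: the restricted product measure, section by section, using left-invariance and the one-fibre chart
  have hL : ((ν.prod κ).restrict (Ψ '' (univ ×ˢ B))) S = ∫⁻ p, ∫⁻ y in B, (Ψ ⁻¹' S).indicator g (p, y) ∂vol ∂ν := by
    rw [Measure.restrict_apply hS, Measure.prod_apply (hS.inter hTm')]
    refine lintegral_congr fun p => ?_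
    -- the `p`-section of `S ∩ Ψ(T)` is the left translate by `s p` of `W_p ∩ E(B)`, `W_p = {w | (p, s p * w) ∈ S}`
    set W : Set Y := (fun w : Y => ((p, s p * w) : M × Y)) ⁻¹' S with hWdef
    have hWm : MeasurableSet W := (measurable_const.prodMk (measurable_const.mul measurable_id)) hS
    have hsec : Prod.mk p ⁻¹' (S ∩ Ψ '' (univ ×ˢ B)) = (fun z : Y => (s p)⁻¹ * z) ⁻¹' (W ∩ E '' B) := by
      rw [himg]
      ext z
      simp only [mem_preimage, mem_inter_iff, hWdef, mul_inv_cancel_left]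
    rw [hsec, measure_preimage_mul κ (s p)⁻¹ (W ∩ E '' B)]
    -- `κ (W ∩ E(B)) = κ|_{E(B)} W`, then the one-fibre chart identity
    rw [show κ (W ∩ E '' B) = κ.restrict (E '' B) W from (Measure.restrict_apply hWm).symm, hchart1,
      Measure.map_apply hE hWm, withDensity_apply _ (hE hWm), Measure.restrict_restrict (hE hWm),
      ← lintegral_indicator ((hE hWm).inter hBm)]
    rw [← lintegral_indicator hBm]
    refine lintegral_congr fun y => ?_
    -- both indicators agree: `y ∈ E⁻¹W ∩ B ↔ (y ∈ B ∧ Ψ(p,y) ∈ S)`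
    by_cases hyB : y ∈ B
    · by_cases hyS : Ψ (p, y) ∈ S
      · have h1 : y ∈ E ⁻¹' W ∩ B := ⟨by simpa [hWdef, hΨdef] using hyS, hyB⟩
        rw [indicator_of_mem h1, indicator_of_mem hyB, indicator_of_mem (show (p, y) ∈ Ψ ⁻¹' S from hyS)]
      · have h1 : y ∉ E ⁻¹' W ∩ B := fun h => hyS (by simpa [hWdef, hΨdef] using h.1)
        rw [indicator_of_notMem h1, indicator_of_mem hyB, indicator_of_notMem (show (p, y) ∉ Ψ ⁻¹' S from hyS)]
    · have h1 : y ∉ E ⁻¹' W ∩ B := fun h => hyB h.2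
      rw [indicator_of_notMem h1, indicator_of_notMem hyB]
  rw [hL, hR]

end Summit.QuantumFields.YangMills.Theorems.QuantitativeLaplace

end
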